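import Summits.PneNP.PneNP.Theorems.ConvexRankGatesLinAlgGateBlindDefs

/-!
# Route ConvexRankGates, crux `LinAlgGateBlind` (stmt-PneNP-10681): rigid span-program term gates satisfy SG

Support lemma for the research stub `stub_sgPerm` of the lines `dnf-invariant-wide-gates-see-small-cliques` and
`konig-atoms-cancellation-split` (skeletons `Summits/PneNP/PneNP/Cruxes/LinAlgGateBlind/Lines/*.lean`), in the
vocabulary of `Theorems/ConvexRankGatesLinAlgGateBlindDefs.lean` (`lostPos`, `gainedNeg`, `smallSets`).

By the refuters' analysis (`Cruxes/LinAlgGateBlind/DrefuteG2SGSharpening.md` §2(b)–(c)) the live candidate violators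
of the single-gate statement `SGAt` for PERM gates are PARITY-TYPE term gates: monotone span programs (which sit
inside abelian PERM gates, `Cruxes/LinAlgGateBlind/Disproof.lean`, `spanProgram_isPermGate`), fed with clique atoms
`⌈X⌉`, `X ∈ 𝒱(l)`; the monotone-circuit reduction of that note cannot reach them (Göös–Kamath–Robere–Sokolov 2019).
A span-program term gate is `O(x) = [t ∈ span_F {r X : X ∈ 𝒱(l), ⌈X⌉(x)}]` for rows `r : Finset (Fin m) → V`
in an `F`-vector space `V` and a target `t ∈ V` (`F` any division ring).

**Theorem (`sg_of_rigidSpanProgram`).** Let `P` be ANY property of graphs such that for all `G, G'` with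
`P G`, `P G'` the rows of the atoms present in BOTH graphs, together with `t`, still span every row:
`r X ∈ span {r Y : ⌈Y⌉(G) ∧ ⌈Y⌉(G')} ⊔ F∙t` for all `X ∈ 𝒱(l)` ("pairwise rigidity"). Then there is a
small-clique DNF `⌈𝒜⌉`, `𝒜 ⊆ 𝒱(l)`, with NO lost positives (`lostPos m k O 𝒜 = ∅` for every `k`) and
`gainedNeg m q O 𝒜 ≤ Pr_{G(m,q)}[¬ P]`. In particular the SG goal holds for `O` at every level `ε ≥ Pr[¬P]`.

Proof (`exists_family_of_rigid_witness`): if some rejected graph `G₁` has `P`, put `W⋆ := span` of its present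
rows (`t ∉ W⋆`) and `𝒜 := {X ∈ 𝒱(l) : r X ∉ W⋆}`. A bare clique `K_S` accepted by `O` has `t` in the span of its
present rows, so one of them lies outside `W⋆`: no positive is lost. If a graph `G` with `P G` is rejected
(`t ∉ W(G)`) and `⌈X⌉(G)` for some `X`, rigidity at `(G₁, G)` writes `r X = u + a•t` with `u ∈ W⋆ ⊓ W(G)`; as
`r X, u ∈ W(G)` and `t ∉ W(G)`, `a = 0`, so `r X ∈ W⋆`, i.e. `X ∉ 𝒜`: on `P`-graphs the rejected ones accept no
atom of `𝒜`, whence `gainedNeg ≤ Pr[¬P]`. If no rejected graph has `P`, `𝒜 := {∅}` loses nothing and gains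
`≤ Pr[O = 0] ≤ Pr[¬P]`. ∎  (So on `P`-graphs a rigid span-program term gate literally coincides with the
small-clique DNF `⌈𝒜⌉`; a violator of `stub_sgPerm` of span-program type must have FRAGILE directions: typical
`G, G'` for which killing the atoms broken in `G ⊓ G'` loses a direction of `span r(𝒱(l))` other than `t`'s —
e.g. unknowns attached to pairs; unknowns attached to vertices are always rigid, see the companion corollary file.)

No new definitions. [folklore] (elementary linear algebra; the statement is new bookkeeping for this crux).
-/

-- `Summit.PneNP.PneNP.…` duplicates `PneNP` BY DESIGN (single-problem summit).
set_option linter.dupNamespace false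

namespace Summit.PneNP.PneNP.Theorems

open Finset Literature.Computability.Complexity Razborov
open Summit.PneNP.PneNP.Cruxes.LinAlgGateBlind.DnfInvariantWideGatesSeeSmallCliques

/-- **Deterministic core.** For a span-program term gate `O` (rows `r`, target `t`, atoms `𝒱(l)`), a property
`P` with pairwise rigidity, and ONE rejected graph `G₁` with `P G₁`: the family
`𝒜 = {X ∈ 𝒱(l) : r X ∉ span {r Y : ⌈Y⌉(G₁)}}` catches every accepted bare clique and is silent on every rejected
`P`-graph. [folklore] -/
theorem exists_family_of_rigid_witness {m l : ℕ} {F V : Type} [DivisionRing F] [AddCommGroup V]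
    [Module F V] (r : Finset (Fin m) → V) (t : V) (O : (KEdge m → Bool) → Bool)
    (hO : ∀ x, O x = true ↔
      t ∈ Submodule.span F (r '' {X | X ∈ smallSets (Fin m) l ∧ CliquePresent X x}))
    (P : (KEdge m → Bool) → Prop)
    (hrigid : ∀ G G', P G → P G' → ∀ X ∈ smallSets (Fin m) l,
      r X ∈ Submodule.span F (r '' {Y | Y ∈ smallSets (Fin m) l ∧ CliquePresent Y G ∧ CliquePresent Y G'})
        ⊔ Submodule.span F {t})
    {G₁ : KEdge m → Bool} (hG₁ : O G₁ = false) (hP₁ : P G₁) :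
    ∃ 𝒜 ⊆ smallSets (Fin m) l,
      (∀ S : Finset (Fin m), O (cliqueVec S) = true → Accepts 𝒜 (cliqueVec S)) ∧
      (∀ G, P G → O G = false → ¬ Accepts 𝒜 G) := by
  classical
  -- the span of the rows present in a graph
  set W : (KEdge m → Bool) → Submodule F V := fun x =>
    Submodule.span F (r '' {X | X ∈ smallSets (Fin m) l ∧ CliquePresent X x}) with hW
  have hOW : ∀ x, O x = false ↔ t ∉ W x := fun x => by
    rw [← hO x]; cases O x <;> simp
  have ht₁ : t ∉ W G₁ := (hOW G₁).1 hG₁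
  refine ⟨(smallSets (Fin m) l).filter fun X => r X ∉ W G₁, filter_subset _ _, ?_, ?_⟩
  · -- no lost positives
    intro S hS
    have htS : t ∈ W (cliqueVec S) := (hO _).1 hS
    by_contra hacc
    -- every present row of `K_S` lies in `W G₁`, hence so does `t`
    have hle : W (cliqueVec S) ≤ W G₁ := by
      refine Submodule.span_le.2 ?_
      rintro _ ⟨X, ⟨hX, hXS⟩, rfl⟩
      by_contra hXW
      exact hacc ⟨X, mem_filter.2 ⟨hX, hXW⟩, hXS⟩
    exact ht₁ (hle htS)
  · -- silent on rejected `P`-graphs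
    rintro G hPG hOG ⟨X, hX𝒜, hXG⟩
    obtain ⟨hX, hXW⟩ := mem_filter.1 hX𝒜
    have htG : t ∉ W G := (hOW G).1 hOG
    have hrX := hrigid G₁ G hP₁ hPG X hX
    rw [Submodule.mem_sup] at hrX
    obtain ⟨u, hu, z, hz, huz⟩ := hrX
    obtain ⟨a, rfl⟩ := Submodule.mem_span_singleton.1 hz
    -- `u` lies in both spans
    have hboth : Submodule.span F
        (r '' {Y | Y ∈ smallSets (Fin m) l ∧ CliquePresent Y G₁ ∧ CliquePresent Y G}) ≤ W G₁ ⊓ W G := by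
      refine Submodule.span_le.2 ?_
      rintro _ ⟨Y, ⟨hY, hY₁, hYG⟩, rfl⟩
      exact ⟨Submodule.subset_span ⟨Y, ⟨hY, hY₁⟩, rfl⟩, Submodule.subset_span ⟨Y, ⟨hY, hYG⟩, rfl⟩⟩
    have hu₁ : u ∈ W G₁ := (hboth hu).1
    have huG : u ∈ W G := (hboth hu).2
    have hrXG : r X ∈ W G := Submodule.subset_span ⟨X, ⟨hX, hXG⟩, rfl⟩
    -- so `a • t ∈ W G`, forcing `a = 0`
    have hat : a • t ∈ W G := by
      have : a • t = r X - u := by rw [← huz]; abel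
      rw [this]
      exact (W G).sub_mem hrXG huG
    have ha : a = 0 := by
      by_contra ha
      exact htG (((W G).smul_mem_iff ha).1 hat)
    subst ha
    rw [zero_smul, add_zero] at huz
    subst huz
    exact hXW hu₁

/-- **Rigid span-program term gates satisfy SG (support lemma for `stub_sgPerm`, stmt-PneNP-10681).**
For a span-program term gate `O(x) = [t ∈ span_F {r X : X ∈ 𝒱(l), ⌈X⌉(x)}]` over any division ring and ANY
graph property `P` with pairwise rigidity (the rows present in both of two `P`-graphs span every row modulo
`t`), some small-clique DNF `⌈𝒜⌉`, `𝒜 ⊆ 𝒱(l)`, loses NO accepted bare `k`-clique and gains at most `Pr[¬P]` of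
`G(m,q)`: `lostPos m k O 𝒜 = ∅ ∧ gainedNeg m q O 𝒜 ≤ prob q ¬P`. [folklore] -/
theorem sg_of_rigidSpanProgram :
    ∀ (m l k : ℕ) (q : ℝ), 0 ≤ q → q ≤ 1 →
    ∀ {F V : Type} [DivisionRing F] [AddCommGroup V] [Module F V]
      (r : Finset (Fin m) → V) (t : V) (O : (KEdge m → Bool) → Bool),
      (∀ x, O x = true ↔
        t ∈ Submodule.span F (r '' {X | X ∈ smallSets (Fin m) l ∧ CliquePresent X x})) →
    ∀ (P : (KEdge m → Bool) → Prop),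
      (∀ G G', P G → P G' → ∀ X ∈ smallSets (Fin m) l,
        r X ∈ Submodule.span F
            (r '' {Y | Y ∈ smallSets (Fin m) l ∧ CliquePresent Y G ∧ CliquePresent Y G'})
          ⊔ Submodule.span F {t}) →
      ∃ 𝒜 ⊆ smallSets (Fin m) l,
        lostPos m k O 𝒜 = ∅ ∧ gainedNeg m q O 𝒜 ≤ prob q (fun G => ¬ P G) := by
  intro m l k q hq0 hq1 F V _ _ _ r t O hO P hrigid
  classical
  by_cases hwit : ∃ G₁, O G₁ = false ∧ P G₁
  · obtain ⟨G₁, hG₁, hP₁⟩ := hwit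
    obtain ⟨𝒜, h𝒜, hpos, hneg⟩ := exists_family_of_rigid_witness r t O hO P hrigid hG₁ hP₁
    refine ⟨𝒜, h𝒜, ?_, ?_⟩
    · refine filter_eq_empty_iff.2 fun S _ h => h.2 (hpos S h.1)
    · exact prob_mono hq0 hq1 fun G hG hPG => hneg G hPG hG.1 hG.2
  · -- every rejected graph violates `P`: the constant-true DNF `⌈{∅}⌉` works
    push Not at hwit
    refine ⟨{∅}, by simp, ?_, ?_⟩
    · exact filter_eq_empty_iff.2 fun S _ h => h.2 (accepts_of_empty_mem (mem_singleton_self _) _)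
    · exact prob_mono hq0 hq1 fun G hG => hwit G hG.1

end Summit.PneNP.PneNP.Theorems
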